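import Summits.AtomisticToContinuum.Crystallization.Theorems.FrustratedLawDichotomyCellTEQ15Data

/-!
# FrustratedLawDichotomy · crux `AperiodicFrustratedLawGap` (stmt-AtomisticToContinuum-27623) — TEQ15 witness cell: removal checks
# (decomp-a2c, prover hand 2, generation 17; each theorem ONE `decide +kernel`, split for the farm's per-declaration budget). [folklore]
-/

namespace Summit.AtomisticToContinuum.Crystallization.Theorems.FrustratedLawDichotomyCellTEQ15

open scoped BigOperators
open Summit.AtomisticToContinuum.Crystallization.Theorems.FrustratedLawDichotomyCellChecker
open Summit.AtomisticToContinuum.Crystallization.Theorems.FrustratedLawDichotomyCellKitX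

set_option maxHeartbeats 0 in
/-- Class `0` passes the removal check (`Σ Ṽ↑ = −1.4098 ≤ −0.7018`). [folklore] -/
theorem teq15_checkRemoval0 : checkRemoval cellTEQ15 cellTEQ15P ⟨0, by decide⟩ = true := by decide +kernel

set_option maxHeartbeats 0 in
/-- Class `1` passes the removal check. [folklore] -/
theorem teq15_checkRemoval1 : checkRemoval cellTEQ15 cellTEQ15P ⟨1, by decide⟩ = true := by decide +kernel

end Summit.AtomisticToContinuum.Crystallization.Theorems.FrustratedLawDichotomyCellTEQ15
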